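import Literature.Analysis.FluidPDE.LerayH1ContinuationForced
import Literature.Analysis.FluidPDE.NSSerrinRegularityProofs
import HarnessLib

/-!
# Forced Ladyzhenskaya–Prodi–Serrin / Sohr's Thm. V.1.8.1 for Clay-class forces,
# from Tao's forced local `H¹` theory

Analysis/FluidPDE proof file (no definitions, no named facts) — the forced twin of the accepted
`NSSerrinRegularityProofs.lean` (Step A) and `NSSerrinRegularityTao.lean` (assembly):

**Main results** (all CONDITIONAL on the single named fact
`tao2011_forced_H1_local_almost_regular`, `TaoH1AlmostRegularForced.lean` — Tao 2013, Thm. 5.4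
with forcing —, exactly as the unforced tree theorems `serrin_regularity_H1_of_tao` /
`ladyzhenskaya_prodi_serrin_of_tao` are conditional on the (now discharged) unforced fact).
Let `ν > 0`, `0 < T`, `f` a Clay-class force (smooth on `[0,∞) × ℝ³` with Fefferman's space-time
decay (5)), and `u` a Leray–Hopf weak solution of the forced Navier–Stokes system on `ℝ³ × [0,T)`
lying in a Serrin class `L^s(0,T; L^q)`, `3 < q ≤ ∞`, `2/s + 3/q ≤ 1`.

* `limsup_eH1NormSq_lt_top_of_serrin_forced` — the continuation hypothesis: at the right end of
  every `H¹`-regular interval the `H¹` norm stays bounded (forced Serrin enstrophy inequality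
  `serrin_enstrophy_le_mul_exp_forced`, Lemarié-Rieusset 2016, Thm. 11.2 (11.11), applied on Tao
  patches and chained);
* `isH1RegularOn_Ioc_of_serrin_forced_of_tao` — `u` is `H¹`-regular on `(0, T]`;
* `Sohr2001_serrinClass_enstrophyBound_clay_of_tao` — **Sohr 2001, Thm. V.1.8.1 ((1.8.2), first
  factor; global-in-time form of the printed proof) for Clay-class forces, AS A THEOREM modulo
  Tao's forced local theory**: if moreover `u₀ ∈ H¹` (square integrable, weakly divergence free,
  square-integrable weak gradient), ONE constant bounds `‖u(t)‖²_{H¹}` — in particular the enstrophy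
  `eWeakGradL2Sq (u t)` — for EVERY `t ∈ (0, T]`, hence a.e. on `(0, T)` (the conclusion shape of the
  tree's named fact `Sohr2001_serrinClass_enstrophyBound_global`, `ForcedSerrinEnstrophyBound.lean`,
  whose unguarded force class is refutable as typed — cell `ns-blowup` KILLSHEET KJ-6; the present
  theorem is its Clay-class specialisation with an honest force).

WHAT THIS IS NOT: not a discharge of `Sohr2001_serrinClass_enstrophyBound(_global)` (force class
`L²(0,T;L²)`, needs a forced `H¹` strong theory for rough forces the tree does not have); not
unconditional (trust base: `tao2011_forced_H1_local_almost_regular`).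

## Proof (the unforced files with the force threaded through)

Step A as in `NSSerrinRegularityProofs.lean`: the bound
`‖∇u(τ)‖² ≤ exp(C ∫_{t₀}^{τ} ‖u‖^{q'}_{L^r}) (‖∇u(t₀)‖² + D (τ - t₀))`, `D = ν⁻¹ sup_t ‖f(t)‖²₂`, is
continued along `[t₀, t]` by real induction (`forall_Icc_of_local_propagation`); near any `σ` a
classical Tao patch from a good restarting time just below `σ` (`exists_tao_patch_forced`: the
forced local solution coincides with `u(· + s)` by the proved forced Serrin–Masuda theorem and is
classically represented on `[ε, τ']` by the fourth clause of `TaoForcedH1AlmostRegularWith`)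
carries `τ₁ ≤ τ₂`; on the translated slab the forced Serrin inequality bounds `‖∇u(τ₂)‖²` by
`‖∇u(τ₁)‖²` plus the work of the force, and the bounds chain (`exp_lintegral_chain_add`). The
kinetic energy is bounded by the forced energy inequality (`IsLerayHopfOn.kineticEnergy_le_forced`).
Leray's forced continuation theorem (`isH1RegularOn_Ioc_forced_of_tao`,
`LerayH1ContinuationForced.lean`) then gives `H¹`-regularity on `(0, T]`, and one more application
of the local theory at `t = 0` (datum in `H¹`) bounds the norm near `t = 0`.

## References

* H. Sohr, *The Navier–Stokes Equations*, Birkhäuser 2001, Ch. V, Thm. 1.8.1 (with its proof,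
  (1.8.16)–(1.8.20)), Thm. 1.5.1. [Sohr2001]
* G. P. Galdi, F. Gazzola, arXiv:2606.15189 (2026), Prop. 2.9 (p. 7). [GaldiGazzola2026]
* J. C. Robinson, J. L. Rodrigo, W. Sadowski, CUP 2016, Lemma 8.16, Thm. 8.17, §8.1.
  [RobinsonRodrigoSadowski2016]
* P. G. Lemarié-Rieusset, *The Navier–Stokes Problem in the 21st Century*, CRC 2016, Thm. 11.2
  (11.11). [LemarieRieusset2016]
* T. Tao, Anal. PDE 6 (2013), Thm. 5.4 / Lemma 5.5. [Tao2011]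
-/

noncomputable section

open MeasureTheory TopologicalSpace Set Function Filter Topology InnerProductSpace Metric
open scoped RealInnerProductSpace ENNReal NNReal

namespace Literature.Analysis.FluidPDE

/-! ### Patches and translation (forced) -/

section Patches

variable {ν T : ℝ} {f : ℝ → EuclideanSpace ℝ (Fin 3) → EuclideanSpace ℝ (Fin 3)}
  {u₀ : EuclideanSpace ℝ (Fin 3) → EuclideanSpace ℝ (Fin 3)}
  {u : ℝ → EuclideanSpace ℝ (Fin 3) → EuclideanSpace ℝ (Fin 3)}

/-- **A classical patch of a forced Leray–Hopf solution from a good time** (Robinson–Rodrigo–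
Sadowski 2016, §8.1, p. 121 and proof of Lemma 6.11, forced form; Sohr 2001, Ch. V, proof of
Thm. 1.8.1). Let `u` be Leray–Hopf on `ℝ³ × [0, T)` with a Clay-class force `f`, `s ∈ (0, T)` a good
restarting time (`u(· + s)` Leray–Hopf with force `f(· + s)` from `u(s)`), `‖u(s)‖²_{H¹} ≤ A`,
`∫₀^{τ'} ‖f(t + s)‖_{H¹} ≤ B` on `τ' = min τ (T - s)` and `(√A + B)⁴ τ ≤ c ν³`. Given Tao's forced
local `H¹` theory with constant `c` (`TaoForcedH1AlmostRegularWith c`), for every `0 < ε < τ'`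
there is a classical solution `(w, π)` of the system forced by `f(· + s)` on the slab `[ε, τ']` in
Tao's `L²`-Sobolev class with `u(t + s) = w(t)` a.e. for every `t ∈ [ε, τ']`: the forced local
solution `v` from `u(s)` lies in the Serrin class `L^∞_t L⁶_x`, so `u(· + s) = v` a.e. by the
proved forced weak–strong uniqueness theorem `serrinMasuda_weak_strong_uniqueness_forced`, and `v`
is represented classically on `[ε, τ']`. [cite: RobinsonRodrigoSadowski2016, §8.1 p. 121 (with Lemma 6.11)] -/
theorem exists_tao_patch_forced {c : ℝ} (hL2 : TaoForcedH1AlmostRegularWith c) (hν : 0 < ν)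
    (hfs : IsSmoothOnHalfSpace f) (hfd : HasRapidSpaceTimeDecay f)
    (hLH : IsLerayHopfOn T ν f u₀ u) {s : ℝ} (hs : s ∈ Ioo 0 T)
    (hLHs : IsLerayHopfOn (T - s) ν (fun t => f (t + s)) (u s) (fun t => u (t + s)))
    {A B τ : ℝ} (hA : 0 ≤ A) (hB : 0 ≤ B) (hAs : eH1NormSq (u s) ≤ ENNReal.ofReal A) (hτ : 0 < τ)
    (hBs : ∫⁻ t in Ioo 0 (min τ (T - s)), eH1NormSq (f (t + s)) ^ (2⁻¹ : ℝ) ≤ ENNReal.ofReal B)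
    (hτc : (Real.sqrt A + B) ^ 4 * τ ≤ c * ν ^ 3)
    {ε : ℝ} (hε : ε ∈ Ioo 0 (min τ (T - s))) :
    ∃ (w : ℝ → EuclideanSpace ℝ (Fin 3) → EuclideanSpace ℝ (Fin 3))
      (π : ℝ → EuclideanSpace ℝ (Fin 3) → ℝ),
      IsClassicalNSSolutionOn (Icc ε (min τ (T - s))) ν (fun t => f (t + s)) w π ∧
      HasBoundedSobolevNormsOn (Icc ε (min τ (T - s))) w ∧
      HasBoundedSobolevNormsOn (Icc ε (min τ (T - s)))
        (timeDerivWithin (Icc ε (min τ (T - s))) w) ∧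
      (∀ n : ℕ, ∃ C : ℝ≥0, ∀ t ∈ Icc ε (min τ (T - s)),
        ∫⁻ x, ‖iteratedFDeriv ℝ n (π t) x‖ₑ ^ 2 ≤ C) ∧
      ∀ t ∈ Icc ε (min τ (T - s)), u (t + s) =ᵐ[volume] w t := by
  set τ' : ℝ := min τ (T - s) with hτ'def
  have hτ' : 0 < τ' := lt_min hτ (sub_pos.2 hs.2)
  have hu2 : MemLp (u s) 2 volume := hLH.memLp s ⟨hs.1.le, hs.2.le⟩
  have hdiv : IsWeaklyDivFree (u s) := hLHs.isWeaklyDivFree_datum (sub_pos.2 hs.2)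
  have hfs' : IsSmoothOnHalfSpace (fun t => f (t + s)) := hfs.timeShift hs.1.le
  have hfd' : HasRapidSpaceTimeDecay (fun t => f (t + s)) := hfd.timeShift hfs hs.1.le
  have hτ'c : (Real.sqrt A + B) ^ 4 * τ' ≤ c * ν ^ 3 :=
    (mul_le_mul_of_nonneg_left (min_le_left _ _) (by positivity)).trans hτc
  obtain ⟨v, hv, -, hvreg, hsmooth⟩ := hL2 hν hτ' hu2 hdiv hfs' hfd' hA hB hAs hBs hτ'c
  -- forced weak–strong uniqueness: `u(t + s) = v(t)` a.e., `0 < t ≤ τ'`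
  have hLHs' : IsLerayHopfOn τ' ν (fun t => f (t + s)) (u s) (fun t => u (t + s)) :=
    hLHs.of_le (min_le_right _ _)
  have hS : MemLqLp ∞ 6 v (Ioo 0 τ') :=
    memLqLp_top_six_of_isH1RegularOn_Icc hvreg fun t ht => hv.memLp t ht
  have hqr : 2 / (⊤ : ℝ≥0∞) + 3 / 6 ≤ 1 := by
    rw [ENNReal.div_top, zero_add]
    exact ENNReal.div_le_of_le_mul (by norm_num)
  have hfm' := clayForce_prod_aestronglyMeasurable (T := τ') hfs'
  have hf2' := clayForce_prod_eLpNorm_lt_top (T := τ') hfs' hfd'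
  have hae : ∀ t ∈ Ioc 0 τ', (fun t => u (t + s)) t =ᵐ[volume] v t :=
    serrinMasuda_weak_strong_uniqueness_forced hν hτ' hfm' hf2' hv hu2 (q := ⊤) (r := 6)
      (by norm_num) hqr hS hLHs'
  obtain ⟨w, π, hw, hbw, hbwt, hbπ, hvw⟩ := hsmooth hε
  refine ⟨w, π, hw, hbw, hbwt, hbπ, fun t ht => ?_⟩
  exact (hae t ⟨hε.1.trans_le ht.1, ht.2⟩).trans (hvw t ht)

end Patches

section Translate

/-- **Time translation of a forced Tao-class classical slab.** A classical solution on
`[a, b] × ℝ³` with force `g` and all `L²` Sobolev norms of `w`, `∂ₜw` (within `[a, b]`) and `π`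
bounded, translated by `e ∈ [a, b)`, is a classical solution on `[0, b - e] × ℝ³` with force
`g(· + e)` and the same bounds (`IsClassicalNSSolutionOn.comp_add_right`; the one-sided time
derivative within the translated slab is the translate of that within `[a, b]`). The forced twin
of the accepted `taoSlab_translate`, same proof (Tao 2013, footnote 3: time translation of smooth
solutions and data). [cite: Tao2011, Thm. 5.4 (iv) (time translation, footnote 3)] -/
theorem taoSlab_translate_forced {ν a b : ℝ}
    {g w : ℝ → EuclideanSpace ℝ (Fin 3) → EuclideanSpace ℝ (Fin 3)}
    {π : ℝ → EuclideanSpace ℝ (Fin 3) → ℝ}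
    (hw : IsClassicalNSSolutionOn (Icc a b) ν g w π) (hbw : HasBoundedSobolevNormsOn (Icc a b) w)
    (hbwt : HasBoundedSobolevNormsOn (Icc a b) (timeDerivWithin (Icc a b) w))
    (hbπ : ∀ n : ℕ, ∃ C : ℝ≥0, ∀ t ∈ Icc a b, ∫⁻ x, ‖iteratedFDeriv ℝ n (π t) x‖ₑ ^ 2 ≤ C)
    {e : ℝ} (he : e ∈ Ico a b) :
    IsClassicalNSSolutionOn (Icc 0 (b - e)) ν (fun t => g (t + e)) (fun t => w (t + e))
      (fun t => π (t + e)) ∧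
    HasBoundedSobolevNormsOn (Icc 0 (b - e)) (fun t => w (t + e)) ∧
    HasBoundedSobolevNormsOn (Icc 0 (b - e))
      (timeDerivWithin (Icc 0 (b - e)) (fun t => w (t + e))) ∧
    ∀ n : ℕ, ∃ C : ℝ≥0, ∀ t ∈ Icc 0 (b - e), ∫⁻ x, ‖iteratedFDeriv ℝ n (π (t + e)) x‖ₑ ^ 2 ≤ C := by
  have hbe : 0 < b - e := sub_pos.2 he.2
  have hsub : Icc 0 (b - e) ⊆ (· + e) ⁻¹' Icc a b := fun t ht =>
    ⟨by simp only; linarith [ht.1, he.1], by simp only; linarith [ht.2]⟩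
  have hsub' : ∀ t ∈ Icc 0 (b - e), t + e ∈ Icc a b := fun t ht => hsub ht
  have hU : UniqueDiffOn ℝ (Icc 0 (b - e)) := uniqueDiffOn_Icc hbe
  have hcl := hw.comp_add_right e
  -- the time derivative of the translate is the translate of the time derivative
  have hdt : ∀ t ∈ Icc 0 (b - e), timeDerivWithin (Icc 0 (b - e)) (fun t => w (t + e)) t =
      timeDerivWithin (Icc a b) w (t + e) := by
    intro t ht
    funext x
    rw [(hw.smooth_velocity.comp_add_right e).timeDerivWithin_eq_of_subset hsub hU ht x,
      timeDerivWithin_comp_add_right]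
  refine ⟨hcl.mono hsub hU, fun n => (hbw n).imp fun C hC t ht => hC (t + e) (hsub' t ht),
    fun n => (hbwt n).imp fun C hC t ht => ?_,
    fun n => (hbπ n).imp fun C hC t ht => hC (t + e) (hsub' t ht)⟩
  rw [hdt t ht]
  exact hC (t + e) (hsub' t ht)

/-- **The enstrophy of a slice represented classically** (forced system): if `v = w(t)` a.e.
with `(w, π)` classical at time `t` (any force), the weak dissipation `eWeakGradL2Sq v` is
`∫ |∇w(t)|²`. The accepted `eWeakGradL2Sq_rep` with a general force. [folklore] -/
private theorem eWeakGradL2Sq_rep_forced {S : Set ℝ}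
    {g w : ℝ → EuclideanSpace ℝ (Fin 3) → EuclideanSpace ℝ (Fin 3)}
    {π : ℝ → EuclideanSpace ℝ (Fin 3) → ℝ} {ν' : ℝ} (hw : IsClassicalNSSolutionOn S ν' g w π) {t : ℝ}
    (ht : t ∈ S) {v : EuclideanSpace ℝ (Fin 3) → EuclideanSpace ℝ (Fin 3)}
    (hrep : v =ᵐ[volume] w t) :
    eWeakGradL2Sq v = ∫⁻ x, ENNReal.ofReal (frobeniusNormSq (fderiv ℝ (w t) x)) := by
  rw [eWeakGradL2Sq_congr_ae hrep]
  exact eWeakGradL2Sq_eq_of_hasWeakGradient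
    (hasWeakGradient_fderiv_of_contDiff ((hw.contDiff_velocity ht).of_le (by norm_cast)))

end Translate

/-! ### Chaining multiplicative-additive bounds along the time axis -/

section Chain

/-- **Chaining of exponential bounds with a source term.** If
`y τ₁ ≤ exp(C ∫_{(t₀,τ₁)} a) (y₀ + D (τ₁ - t₀))` and `y τ₂ ≤ exp(C ∫_{(τ₁,τ₂)} a) (y τ₁ + D (τ₂ - τ₁))`
with `t₀ ≤ τ₁ ≤ τ₂`, `C ≥ 0` and `∫_{(t₀,τ₂)} a < ∞`, then
`y τ₂ ≤ exp(C ∫_{(t₀,τ₂)} a) (y₀ + D (τ₂ - t₀))` (additivity of the integral, `exp ≥ 1`; the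
Grönwall bookkeeping of Lemarié-Rieusset 2016, Thm. 11.2, iterated over adjacent slabs). [cite: LemarieRieusset2016, Thm. 11.2 (11.11) (iteration over adjacent slabs)] -/
theorem exp_lintegral_chain_add {y : ℝ → ℝ≥0∞} {a : ℝ → ℝ≥0∞} {C : ℝ} {y₀ D : ℝ≥0∞}
    {t₀ τ₁ τ₂ : ℝ} (h01 : t₀ ≤ τ₁) (h12 : τ₁ ≤ τ₂) (hC : 0 ≤ C)
    (hfin : ∫⁻ σ in Ioo t₀ τ₂, a σ ≠ ⊤)
    (hP1 : y τ₁ ≤ ENNReal.ofReal (Real.exp (C * (∫⁻ σ in Ioo t₀ τ₁, a σ).toReal)) *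
      (y₀ + D * ENNReal.ofReal (τ₁ - t₀)))
    (hstep : y τ₂ ≤ ENNReal.ofReal (Real.exp (C * (∫⁻ σ in Ioo τ₁ τ₂, a σ).toReal)) *
      (y τ₁ + D * ENNReal.ofReal (τ₂ - τ₁))) :
    y τ₂ ≤ ENNReal.ofReal (Real.exp (C * (∫⁻ σ in Ioo t₀ τ₂, a σ).toReal)) *
      (y₀ + D * ENNReal.ofReal (τ₂ - t₀)) := by
  have hsplit : ∫⁻ σ in Ioo t₀ τ₂, a σ = (∫⁻ σ in Ioo t₀ τ₁, a σ) + ∫⁻ σ in Ioo τ₁ τ₂, a σ := by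
    rw [lintegral_Ioo_eq_lintegral_Ioc, lintegral_Ioo_eq_lintegral_Ioc,
      lintegral_Ioo_eq_lintegral_Ioc, lintegral_Ioc_add_Ioc h01 h12]
  have hfin1 : ∫⁻ σ in Ioo t₀ τ₁, a σ ≠ ⊤ :=
    ne_top_of_le_ne_top hfin (hsplit ▸ le_self_add)
  have hfin2 : ∫⁻ σ in Ioo τ₁ τ₂, a σ ≠ ⊤ :=
    ne_top_of_le_ne_top hfin (hsplit ▸ le_add_self)
  have hreal : (∫⁻ σ in Ioo t₀ τ₂, a σ).toReal =
      (∫⁻ σ in Ioo t₀ τ₁, a σ).toReal + (∫⁻ σ in Ioo τ₁ τ₂, a σ).toReal := by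
    rw [hsplit, ENNReal.toReal_add hfin1 hfin2]
  set E01 : ℝ≥0∞ := ENNReal.ofReal (Real.exp (C * (∫⁻ σ in Ioo t₀ τ₁, a σ).toReal)) with hE01
  set E12 : ℝ≥0∞ := ENNReal.ofReal (Real.exp (C * (∫⁻ σ in Ioo τ₁ τ₂, a σ).toReal)) with hE12
  -- `exp ≥ 1`
  have hE01_one : 1 ≤ E01 := by
    rw [hE01, ← ENNReal.ofReal_one]
    exact ENNReal.ofReal_le_ofReal (Real.one_le_exp (mul_nonneg hC ENNReal.toReal_nonneg))
  have hsum : D * ENNReal.ofReal (τ₁ - t₀) + D * ENNReal.ofReal (τ₂ - τ₁) =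
      D * ENNReal.ofReal (τ₂ - t₀) := by
    rw [← mul_add, ← ENNReal.ofReal_add (by linarith) (by linarith)]
    congr 2; ring
  calc y τ₂ ≤ E12 * (y τ₁ + D * ENNReal.ofReal (τ₂ - τ₁)) := hstep
    _ ≤ E12 * (E01 * (y₀ + D * ENNReal.ofReal (τ₁ - t₀)) + E01 * (D * ENNReal.ofReal (τ₂ - τ₁))) :=
        mul_le_mul' le_rfl (add_le_add hP1 (le_mul_of_one_le_left zero_le hE01_one))
    _ = E12 * E01 * (y₀ + D * ENNReal.ofReal (τ₂ - t₀)) := by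
        rw [← mul_add, ← mul_assoc, add_assoc, hsum]
    _ = ENNReal.ofReal (Real.exp (C * (∫⁻ σ in Ioo t₀ τ₂, a σ).toReal)) *
          (y₀ + D * ENNReal.ofReal (τ₂ - t₀)) := by
        rw [hE12, hE01, ← ENNReal.ofReal_mul (Real.exp_nonneg _), ← Real.exp_add, hreal]
        congr 3; ring

end Chain

/-! ### Step A (forced): the Serrin bound at the right end of an interval of regularity -/

section StepA

variable {ν T : ℝ} {f : ℝ → EuclideanSpace ℝ (Fin 3) → EuclideanSpace ℝ (Fin 3)}
  {u₀ : EuclideanSpace ℝ (Fin 3) → EuclideanSpace ℝ (Fin 3)}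
  {u : ℝ → EuclideanSpace ℝ (Fin 3) → EuclideanSpace ℝ (Fin 3)}

/-- **Uniform enstrophy bound towards the right end of an interval of regularity, in a Serrin
class, FORCED system** (Sohr 2001, Ch. V, proof of Thm. 1.8.1, (1.8.16)–(1.8.20): a bound with a
constant independent of the subinterval, iterated; Robinson–Rodrigo–Sadowski 2016, proof of
Lemma 8.16: "blowup at time `T₁` is impossible"). Let `u` be Leray–Hopf on `ℝ³ × [0, T)` with a
Clay-class force and finite Serrin integral `Ā = ∫₀ᵀ ‖u‖_{L^r}^{q'} < ∞` (`3 < r ≤ ∞`,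
`q' = 2/(1 - 3/r)`), `H¹`-regular on an open interval `(α, β) ⊆ (0, T)`, and `t₀ ∈ (α, β)`. Given
Tao's forced local `H¹` theory (`TaoForcedH1AlmostRegularWith c`, `c > 0`), there is `K < ∞`
with `‖∇u(t)‖² ≤ K` for every `t ∈ [t₀, β)`, namely
`K = exp(C_ν Ā) (‖∇u(t₀)‖² + ν⁻¹ M_f T)` with `M_f ≥ sup_t ‖f(t)‖²_{L²}` and `C_ν` the constant of
the forced Serrin enstrophy inequality `serrin_enstrophy_le_mul_exp_forced` (Lemarié-Rieusset 2016,
Thm. 11.2). Proof: the propagated bound is continued along `[t₀, t]` by real induction; near any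
`σ` a classical patch from a good time just below `σ` (`exists_tao_patch_forced`, lifespan uniform
thanks to the `H¹` bound on a compact and the uniform force budget) carries `τ₁ ≤ τ₂` via the
forced slab inequality on the translated patch, and the bounds chain
(`exp_lintegral_chain_add`). [cite: Sohr2001, Ch. V Thm. 1.8.1 (proof, (1.8.16)–(1.8.20))] -/
theorem exists_eWeakGradL2Sq_le_of_serrin_forced {c : ℝ} (hL2 : TaoForcedH1AlmostRegularWith c)
    (hc : 0 < c) (hν : 0 < ν) (hfs : IsSmoothOnHalfSpace f) (hfd : HasRapidSpaceTimeDecay f)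
    (hLH : IsLerayHopfOn T ν f u₀ u) {r : ℝ≥0∞} (hr : 3 < r)
    (hA : ∫⁻ t in Ioo 0 T, ENNReal.ofReal
      ((eLpNorm (u t) r volume).toReal ^ (2 / (1 - (3 / r).toReal))) ≠ ⊤)
    {α β : ℝ} (hα : 0 ≤ α) (hβ : β ≤ T) (hreg : IsH1RegularOn (Ioo α β) u)
    {t₀ : ℝ} (ht₀ : t₀ ∈ Ioo α β) :
    ∃ K : ℝ≥0∞, K < ⊤ ∧ ∀ t ∈ Ico t₀ β, eWeakGradL2Sq (u t) ≤ K := by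
  have ht₀0 : 0 < t₀ := hα.trans_lt ht₀.1
  have hT : 0 < T := ht₀0.trans_le (ht₀.2.le.trans hβ)
  -- the exponent and Serrin's constant (forced slab inequality)
  set θ : ℝ := 1 - (3 / r).toReal with hθ
  have h3r : (3 / r).toReal < 1 := by
    rcases eq_or_ne r ⊤ with hrtop | hrtop
    · rw [hrtop, ENNReal.div_top, ENNReal.toReal_zero]; exact zero_lt_one
    · have hρ3 : 3 < r.toReal := by
        rw [← ENNReal.toReal_ofNat 3]; exact (ENNReal.toReal_lt_toReal (by norm_num) hrtop).2 hr
      rw [ENNReal.toReal_div, ENNReal.toReal_ofNat, div_lt_one (by linarith)]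
      exact hρ3
  have hθ0 : 0 < θ := by rw [hθ]; linarith
  have hθ1 : θ ≤ 1 := by rw [hθ]; linarith [ENNReal.toReal_nonneg (a := 3 / r)]
  set Kc : ℝ≥0 := SNormLESNormFDerivOfEqConst (EuclideanSpace ℝ (Fin 3))
    (volume : Measure (EuclideanSpace ℝ (Fin 3))) 2 with hKc
  set Cν : ℝ := 2 * (θ * (2 * (1 - θ)) ^ ((1 - θ) / θ) * 2 ^ (-(1 / θ)) *
      (Kc : ℝ) ^ (2 * (1 - θ) / θ)) * (ν / 2) ^ (1 - 2 / θ) with hCν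
  have hCν0 : 0 ≤ Cν := by
    have : 0 ≤ 1 - θ := by linarith
    positivity
  have hq' : (2 : ℝ) / (1 - (3 / r).toReal) = 2 / θ := by rw [hθ]
  set a : ℝ → ℝ≥0∞ := fun σ => ENNReal.ofReal ((eLpNorm (u σ) r volume).toReal ^ (2 / θ)) with ha
  have hA' : ∫⁻ t in Ioo 0 T, a t ≠ ⊤ := by rw [ha]; simpa only [hq'] using hA
  -- force bookkeeping: `L²` slice bounds of the Clay force and the work rate `D`
  obtain ⟨C₀, hC₀⟩ := hfd.exists_lintegral_iteratedFDeriv_slice_sq_le (μ := volume) hfs 0 zero_le_one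
  obtain ⟨C₁, hC₁⟩ := hfd.exists_lintegral_iteratedFDeriv_slice_sq_le (μ := volume) hfs 1 le_rfl
  set D : ℝ≥0∞ := (ENNReal.ofReal ν)⁻¹ * C₀ with hD
  have hDtop : D < ⊤ :=
    ENNReal.mul_lt_top (ENNReal.inv_lt_top.2 (ENNReal.ofReal_pos.2 hν)) ENNReal.coe_lt_top
  obtain ⟨B, hB, hBle⟩ := clayForce_lintegral_sqrt_eH1NormSq_translate_le hfs hfd T
  have hfm := clayForce_prod_aestronglyMeasurable (T := T) hfs
  have hf2 := clayForce_prod_eLpNorm_lt_top (T := T) hfs hfd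
  -- the initial enstrophy
  set y₀ : ℝ≥0∞ := eWeakGradL2Sq (u t₀) with hy₀def
  have hy₀ : y₀ < ⊤ := lt_of_le_of_lt le_add_self (hreg.eH1NormSq_lt_top ht₀)
  refine ⟨ENNReal.ofReal (Real.exp (Cν * (∫⁻ σ in Ioo 0 T, a σ).toReal)) *
      (y₀ + D * ENNReal.ofReal T), ?_, fun t ht => ?_⟩
  · exact ENNReal.mul_lt_top ENNReal.ofReal_lt_top (ENNReal.add_lt_top.2
      ⟨hy₀, ENNReal.mul_lt_top hDtop ENNReal.ofReal_lt_top⟩)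
  -- good restarting times
  have hgood : ∀ᵐ s ∂(volume.restrict (Ioo 0 T)),
      IsLerayHopfOn (T - s) ν (fun t => f (t + s)) (u s) (fun t => u (t + s)) :=
    hLH.ae_isLerayHopfOn_restart_forced hν.le hfm hf2
  -- a uniform `H¹` bound on the compact `[(α + t₀)/2, t]`
  have hKsub : Icc ((α + t₀) / 2) t ⊆ Ioo α β := fun s hs =>
    ⟨lt_of_lt_of_le (by linarith [ht₀.1]) hs.1, hs.2.trans_lt ht.2⟩
  obtain ⟨M, hM, hbound⟩ := hreg.exists_forall_le isCompact_Icc hKsub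
  set Am : ℝ := M.toReal with hAm
  have hAm0 : 0 ≤ Am := ENNReal.toReal_nonneg
  set τM : ℝ := c * ν ^ 3 / ((Real.sqrt Am + B) ^ 4 + 1) with hτM
  have hτM0 : 0 < τM := by positivity
  have hτMc : (Real.sqrt Am + B) ^ 4 * τM ≤ c * ν ^ 3 := by
    rw [hτM, mul_div_assoc']
    rw [div_le_iff₀ (by positivity)]
    nlinarith [pow_nonneg (add_nonneg (Real.sqrt_nonneg Am) hB) 4, mul_pos hc (pow_pos hν 3)]
  -- the propagated property
  set AI : ℝ → ℝ := fun τ => (∫⁻ σ in Ioo t₀ τ, a σ).toReal with hAIdef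
  set P : ℝ → Prop := fun τ => eWeakGradL2Sq (u τ) ≤
    ENNReal.ofReal (Real.exp (Cν * AI τ)) * (y₀ + D * ENNReal.ofReal (τ - t₀)) with hPdef
  have hPt : P t := by
    refine forall_Icc_of_local_propagation (a := t₀) (b := t) (P := P) ?_ ?_ t ⟨ht.1, le_rfl⟩
    · -- `P t₀`
      simp only [hPdef, hAIdef, Ioo_self, Measure.restrict_empty, lintegral_zero_measure,
        ENNReal.toReal_zero, mul_zero, Real.exp_zero, ENNReal.ofReal_one, one_mul, sub_self,
        ENNReal.ofReal_zero, add_zero, hy₀def, le_refl]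
    · -- local propagation around `σ ∈ [t₀, t]`
      intro σ hσ
      have hσT : σ ≤ T := (hσ.2.trans ht.2.le).trans hβ
      -- a good time `s` just below `σ`
      have hlo : 0 ≤ max ((α + t₀) / 2) (σ - τM / 2) := le_max_of_le_left (by linarith)
      have hlt : max ((α + t₀) / 2) (σ - τM / 2) < σ :=
        max_lt (by linarith [hσ.1, ht₀.1]) (by linarith)
      obtain ⟨s, hs, hLHs⟩ := exists_mem_Ioo_of_ae_restrict_Ioo hlo hlt hσT hgood
      have hs1 : (α + t₀) / 2 < s := (le_max_left _ _).trans_lt hs.1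
      have hs2 : σ - τM / 2 < s := (le_max_right _ _).trans_lt hs.1
      have hs0 : 0 < s := lt_of_le_of_lt (by linarith) hs1
      have hsT : s < T := hs.2.trans_le hσT
      have hsK : s ∈ Icc ((α + t₀) / 2) t := ⟨hs1.le, hs.2.le.trans hσ.2⟩
      have hAs : eH1NormSq (u s) ≤ ENNReal.ofReal Am := by
        rw [hAm, ENNReal.ofReal_toReal hM.ne]; exact hbound s hsK
      set τ' : ℝ := min τM (T - s) with hτ'def
      have hBs : ∫⁻ t' in Ioo 0 τ', eH1NormSq (f (t' + s)) ^ (2⁻¹ : ℝ) ≤ ENNReal.ofReal B :=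
        hBle s hs0.le _ ((min_le_right _ _).trans (by linarith))
      refine ⟨min (σ - s) (τM / 2), lt_min (sub_pos.2 hs.2) (by positivity), ?_⟩
      intro τ₁ hτ₁ τ₂ hτ₂ hτ₁σ hτ₁₂ hτ₂σ hP1
      rcases eq_or_lt_of_le hτ₁₂ with heq | hlt12
      · rw [← heq]; exact hP1
      -- the patch from `s` covers `[τ₁, τ₂]`
      have hδ1 : min (σ - s) (τM / 2) ≤ σ - s := min_le_left _ _
      have hδ2 : min (σ - s) (τM / 2) ≤ τM / 2 := min_le_right _ _
      have hsτ₁ : s < τ₁ := by linarith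
      have hτ₂τ' : τ₂ - s < τ' := by
        refine lt_min (by linarith) ?_
        linarith [hτ₂.2, ht.2, hβ]
      set ε : ℝ := τ₁ - s with hεdef
      have hε0 : 0 < ε := sub_pos.2 hsτ₁
      have hετ' : ε < τ' := lt_trans (by rw [hεdef]; linarith) hτ₂τ'
      obtain ⟨w, π, hw, hbw, hbwt, hbπ, hrep⟩ := exists_tao_patch_forced hL2 hν hfs hfd hLH
        ⟨hs0, hsT⟩ hLHs hAm0 hB hAs hτM0 hBs hτMc (ε := ε) ⟨hε0, hετ'⟩
      -- translate to the slab `[0, τ' - ε]`, i.e. `u`-times `[τ₁, s + τ']`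
      obtain ⟨hw', hbw', hbwt', hbπ'⟩ := taoSlab_translate_forced hw hbw hbwt hbπ (e := ε)
        ⟨le_rfl, hετ'⟩
      have hL : 0 < τ' - ε := sub_pos.2 hετ'
      have hrep' : ∀ t' ∈ Icc 0 (τ' - ε), u (t' + τ₁) =ᵐ[volume] w (t' + ε) := by
        intro t' ht'
        have h := hrep (t' + ε) ⟨by linarith [ht'.1], by linarith [ht'.2]⟩
        have e1 : t' + ε + s = t' + τ₁ := by rw [hεdef]; ring
        rwa [e1] at h
      have hs12 : τ₂ - τ₁ ∈ Ioc 0 (τ' - ε) := ⟨sub_pos.2 hlt12, by rw [hεdef]; linarith⟩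
      -- the Serrin integral of the representative
      have hint := lintegral_serrin_rep (r := r) (q' := 2 / θ) hrep' hs12.2
      have e2 : τ₁ + (τ₂ - τ₁) = τ₂ := by ring
      rw [e2] at hint
      have hsub12 : Ioo τ₁ τ₂ ⊆ Ioo 0 T :=
        Ioo_subset_Ioo (by linarith [hτ₁.1]) (by linarith [hτ₂.2, ht.2])
      have hfin12 : ∫⁻ σ' in Ioo τ₁ τ₂, a σ' ≠ ⊤ := ne_top_of_le_ne_top hA' (lintegral_mono_set hsub12)
      have hfinw : ∫⁻ t' in Ioo 0 (τ₂ - τ₁), ENNReal.ofReal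
          ((eLpNorm (w (t' + ε)) r volume).toReal ^ (2 / θ)) ≠ ⊤ := by
        rw [hint]; exact hfin12
      -- force bounds on the translated slab (the force there is `f(· + ε + s)`, Clay class)
      have hshift : ∀ t' ∈ Icc 0 (τ' - ε), 0 ≤ t' + ε + s := fun t' ht' => by
        linarith [ht'.1, hε0.le, hs0.le]
      have hf' : ∀ n : ℕ, n ≤ 1 → ∃ C : ℝ≥0, ∀ t' ∈ Icc 0 (τ' - ε),
          ∫⁻ x, ‖iteratedFDeriv ℝ n ((fun t => (fun t => f (t + s)) (t + ε)) t') x‖ₑ ^ 2 ≤ C := by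
        intro n hn
        obtain ⟨C, hC⟩ := hfd.exists_lintegral_iteratedFDeriv_slice_sq_le (μ := volume) hfs n hn
        exact ⟨C, fun t' ht' => by simpa only [add_assoc] using hC (t' + (ε + s)) (by linarith [hshift t' ht'])⟩
      have hF' : ∀ t' ∈ Ioo 0 (τ' - ε),
          ∫⁻ x, ‖(fun t => (fun t => f (t + s)) (t + ε)) t' x‖ₑ ^ 2 ≤ (fun _ : ℝ => (C₀ : ℝ≥0∞)) t' := by
        intro t' ht'
        have h := hC₀ (t' + ε + s) (hshift t' (Ioo_subset_Icc_self ht'))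
        refine le_trans (le_of_eq (lintegral_congr fun x => ?_)) h
        simp only [norm_iteratedFDeriv_zero, ← ofReal_norm]
      have hFs : ∫⁻ t' in Ioo 0 (τ₂ - τ₁), (fun _ : ℝ => (C₀ : ℝ≥0∞)) t' ≠ ⊤ := by
        rw [setLIntegral_const, Real.volume_Ioo]
        exact ENNReal.mul_ne_top ENNReal.coe_ne_top ENNReal.ofReal_ne_top
      -- Serrin's forced enstrophy inequality on the translated slab
      have hineq := serrin_enstrophy_le_mul_exp_forced hν hL hw' hbw' hbwt' hbπ' hf'
        (fun _ => (C₀ : ℝ≥0∞)) measurable_const hF' hr hθ hs12 hfinw hFs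
      rw [hint, setLIntegral_const, Real.volume_Ioo, sub_zero] at hineq
      -- identify the enstrophies with those of `u`
      have hy2 : eWeakGradL2Sq (u τ₂) =
          ∫⁻ x, ENNReal.ofReal (frobeniusNormSq (fderiv ℝ (w (τ₂ - τ₁ + ε)) x)) := by
        have h := eWeakGradL2Sq_rep_forced hw' ⟨hs12.1.le, hs12.2⟩
          (hrep' (τ₂ - τ₁) ⟨hs12.1.le, hs12.2⟩)
        rwa [sub_add_cancel] at h
      have hy1 : eWeakGradL2Sq (u τ₁) =
          ∫⁻ x, ENNReal.ofReal (frobeniusNormSq (fderiv ℝ (w (0 + ε)) x)) := by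
        have h := eWeakGradL2Sq_rep_forced hw' ⟨le_rfl, hL.le⟩ (hrep' 0 ⟨le_rfl, hL.le⟩)
        rwa [zero_add τ₁] at h
      have hstep : eWeakGradL2Sq (u τ₂) ≤
          ENNReal.ofReal (Real.exp (Cν * (∫⁻ σ' in Ioo τ₁ τ₂, a σ').toReal)) *
            (eWeakGradL2Sq (u τ₁) + D * ENNReal.ofReal (τ₂ - τ₁)) := by
        rw [hy2, hy1, hD]
        rw [← mul_assoc ((ENNReal.ofReal ν)⁻¹) (C₀ : ℝ≥0∞) (ENNReal.ofReal (τ₂ - τ₁))] at hineq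
        exact hineq
      have hfin02 : ∫⁻ σ' in Ioo t₀ τ₂, a σ' ≠ ⊤ :=
        ne_top_of_le_ne_top hA' (lintegral_mono_set (Ioo_subset_Ioo ht₀0.le (by linarith [hτ₂.2, ht.2])))
      exact exp_lintegral_chain_add (y := fun τ => eWeakGradL2Sq (u τ)) (a := a) (C := Cν) (y₀ := y₀)
        (D := D) hτ₁.1 hτ₁₂ hCν0 hfin02 hP1 hstep
  -- conclusion
  refine hPt.trans (mul_le_mul' ?_ ?_)
  · refine ENNReal.ofReal_le_ofReal (Real.exp_le_exp.2 (mul_le_mul_of_nonneg_left ?_ hCν0))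
    exact ENNReal.toReal_mono hA' (lintegral_mono_set (Ioo_subset_Ioo ht₀0.le ((ht.2.le).trans hβ)))
  · gcongr
    linarith [ht.2, hβ, ht₀0]

/-- **The kinetic energy of a forced Leray–Hopf solution is bounded on `[0, T]`** by the datum's
energy plus the total work `∫₀ᵀ|∫⟪f, u⟫|` (forced energy inequality, Sohr 2001, Ch. V (1.5.3);
`IsLerayHopfOn.kineticEnergy_le_forced`), in the form `eEnergy (u t) ≤ ofReal (2 (E(u₀) + W))`.
[cite: Sohr2001, Ch. V §1.4, proof of Thm. 1.4.1 (bookkeeping step)] -/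
theorem IsLerayHopfOn.eEnergy_le_forced (hLH : IsLerayHopfOn T ν f u₀ u) (hν : 0 ≤ ν)
    (hfm : AEStronglyMeasurable (uncurry f)
      ((volume.restrict (Ioo 0 T)).prod (volume : Measure (EuclideanSpace ℝ (Fin 3)))))
    (hf2 : eLpNorm (uncurry f) 2
      ((volume.restrict (Ioo 0 T)).prod (volume : Measure (EuclideanSpace ℝ (Fin 3)))) < ⊤)
    {t : ℝ} (ht : t ∈ Icc 0 T) :
    eEnergy (u t) ≤ ENNReal.ofReal (2 * (VectorCalculus.kineticEnergy u₀ +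
      ∫ τ in Ioo 0 T, |∫ x, ⟪f τ x, u τ x⟫|)) := by
  obtain ⟨G, -, -, hE, -⟩ := hLH.weakGrad_energy
  rw [eEnergy_eq_ofReal _ (hLH.memLp t ht)]
  exact ENNReal.ofReal_le_ofReal (by linarith [hLH.kineticEnergy_le_forced hν hfm hf2 hE ht])

/-- **The continuation hypothesis in a Serrin class, FORCED system**: for a Leray–Hopf solution on
`ℝ³ × [0, T)` of the system forced by a Clay-class `f`, with finite Serrin integral,
`limsup_{t → β⁻} ‖u(t)‖²_{H¹} < ∞` at the right end `β` of every `H¹`-regular interval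
`(α, β) ⊆ (0, T)` — the hypothesis of Leray's forced continuation theorem
`isH1RegularOn_Ioc_forced_of_tao`: the kinetic energy is bounded (`IsLerayHopfOn.eEnergy_le_forced`)
and the enstrophy by `exists_eWeakGradL2Sq_le_of_serrin_forced` (Sohr 2001, Ch. V, proof of
Thm. 1.8.1: no blow-up of `‖A^{1/2}u‖` inside `(0, T]`; Robinson–Rodrigo–Sadowski 2016, proof of
Lemma 8.16). Given Tao's forced local `H¹` theory with constant `c > 0`. [cite: Sohr2001, Ch. V Thm. 1.8.1 (proof, (1.8.16)–(1.8.20))] -/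
theorem limsup_eH1NormSq_lt_top_of_serrin_forced {c : ℝ} (hL2 : TaoForcedH1AlmostRegularWith c)
    (hc : 0 < c) (hν : 0 < ν) (hfs : IsSmoothOnHalfSpace f) (hfd : HasRapidSpaceTimeDecay f)
    (hLH : IsLerayHopfOn T ν f u₀ u) {r : ℝ≥0∞} (hr : 3 < r)
    (hA : ∫⁻ t in Ioo 0 T, ENNReal.ofReal
      ((eLpNorm (u t) r volume).toReal ^ (2 / (1 - (3 / r).toReal))) ≠ ⊤)
    {α β : ℝ} (hα : 0 ≤ α) (hαβ : α < β) (hβ : β ≤ T) (hreg : IsH1RegularOn (Ioo α β) u) :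
    limsup (fun t => eH1NormSq (u t)) (𝓝[<] β) < ⊤ := by
  set t₀ : ℝ := (α + β) / 2 with ht₀
  have ht₀m : t₀ ∈ Ioo α β := ⟨by rw [ht₀]; linarith, by rw [ht₀]; linarith⟩
  obtain ⟨K, hK, hbound⟩ :=
    exists_eWeakGradL2Sq_le_of_serrin_forced hL2 hc hν hfs hfd hLH hr hA hα hβ hreg ht₀m
  have hfm := clayForce_prod_aestronglyMeasurable (T := T) hfs
  have hf2 := clayForce_prod_eLpNorm_lt_top (T := T) hfs hfd
  set E₀ : ℝ≥0∞ := ENNReal.ofReal (2 * (VectorCalculus.kineticEnergy u₀ +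
    ∫ τ in Ioo 0 T, |∫ x, ⟪f τ x, u τ x⟫|)) with hE₀
  have hev : ∀ᶠ t in 𝓝[<] β, eH1NormSq (u t) ≤ E₀ + K := by
    filter_upwards [Ioo_mem_nhdsLT ht₀m.2] with t ht
    have htT : t ∈ Icc 0 T := ⟨(hα.trans ht₀m.1.le).trans ht.1.le, ht.2.le.trans hβ⟩
    exact add_le_add (hLH.eEnergy_le_forced hν.le hfm hf2 htT) (hbound t ⟨ht.1.le, ht.2⟩)
  refine lt_of_le_of_lt (Filter.limsup_le_of_le (by isBoundedDefault) hev) ?_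
  exact ENNReal.add_lt_top.2 ⟨ENNReal.ofReal_lt_top, hK⟩

end StepA

/-! ### Assembly: `H¹`-regularity on `(0, T]` and Sohr's enstrophy bound for Clay-class forces -/

section Assembly

variable {ν T : ℝ} {f : ℝ → EuclideanSpace ℝ (Fin 3) → EuclideanSpace ℝ (Fin 3)}
  {u₀ : EuclideanSpace ℝ (Fin 3) → EuclideanSpace ℝ (Fin 3)}
  {u : ℝ → EuclideanSpace ℝ (Fin 3) → EuclideanSpace ℝ (Fin 3)}

/-- **A forced Leray–Hopf solution in a Serrin class is `H¹`-regular on `(0, T]`** (Clay-class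
force; Robinson–Rodrigo–Sadowski 2016, Thm. 8.17 / Lemma 8.16, forced; Sohr 2001, Thm. V.1.8.1):
Leray's forced continuation theorem `isH1RegularOn_Ioc_forced_of_tao` with the continuation
hypothesis supplied by `limsup_eH1NormSq_lt_top_of_serrin_forced`. Exponents as in the tree's
ns.S07: `3 < r ≤ ∞`, `2/q + 3/r ≤ 1` (`q` time, `r` space). CONDITIONAL on
`tao2011_forced_H1_local_almost_regular`. [cite: RobinsonRodrigoSadowski2016, Thm. 8.17 (with Lemma 8.16)] -/
theorem isH1RegularOn_Ioc_of_serrin_forced_of_tao (h : tao2011_forced_H1_local_almost_regular)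
    (hν : 0 < ν) (hfs : IsSmoothOnHalfSpace f) (hfd : HasRapidSpaceTimeDecay f)
    (hLH : IsLerayHopfOn T ν f u₀ u) {q r : ℝ≥0∞} (hr : 3 < r) (hqr : 2 / q + 3 / r ≤ 1)
    (hS : MemLqLp q r u (Ioo 0 T)) : IsH1RegularOn (Ioc 0 T) u := by
  obtain ⟨c, hc, hL2⟩ := h
  have hA := (lintegral_ofReal_rpow_serrin_lt_top hr hqr hS).ne
  exact isH1RegularOn_Ioc_forced_of_tao ⟨c, hc, hL2⟩ hν hfs hfd hLH fun α β hα hαβ hβ hregI =>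
    limsup_eH1NormSq_lt_top_of_serrin_forced hL2 hc hν hfs hfd hLH hr hA hα hαβ hβ hregI

/-- **Sohr 2001, Thm. V.1.8.1 ((1.8.2), first factor) / Galdi–Gazzola 2026, Prop. 2.9, for
Clay-class forces — a THEOREM modulo Tao's forced local `H¹` theory, pointwise form.** Let
`ν > 0`, `0 < T`, `f` smooth on `[0,∞) × ℝ³` with Fefferman's space-time decay, `u₀ ∈ H¹_σ`
(`u₀ ∈ L²`, weakly divergence free, square-integrable weak gradient), and let `u` be a Leray–Hopf
weak solution of the forced system on `ℝ³ × [0, T)` with data `f, u₀` lying in a Serrin class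
`L^q(0,T; L^r)`, `3 < r ≤ ∞`, `2/q + 3/r ≤ 1`. Then ONE finite constant bounds `‖u(t)‖²_{H¹}` for
every `t ∈ (0, T]`: `H¹`-regularity on `(0, T]` (`isH1RegularOn_Ioc_of_serrin_forced_of_tao`)
bounds the norm on every `[δ, T]`, and near `t = 0` the forced local solution from the `H¹` datum
`u₀` (Tao's Thm. 5.4 (i)–(ii) with force), which coincides with `u` by forced Serrin–Masuda
uniqueness, is `H¹`-continuous on `[0, δ]`. [cite: Sohr2001, Ch. V Thm. 1.8.1 (eq. (1.8.2), first factor)] -/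
theorem exists_eH1NormSq_le_of_serrin_forced_of_tao (h : tao2011_forced_H1_local_almost_regular)
    (hν : 0 < ν) (hT : 0 < T) (hfs : IsSmoothOnHalfSpace f) (hfd : HasRapidSpaceTimeDecay f)
    (hu₀ : MemLp u₀ 2 volume) (hu₀σ : IsWeaklyDivFree u₀) (hu₀grad : eWeakGradL2Sq u₀ < ⊤)
    (hLH : IsLerayHopfOn T ν f u₀ u) {q r : ℝ≥0∞} (hr : 3 < r) (hqr : 2 / q + 3 / r ≤ 1)
    (hS : MemLqLp q r u (Ioo 0 T)) :
    ∃ C : ℝ≥0∞, C < ⊤ ∧ ∀ t ∈ Ioc 0 T, eH1NormSq (u t) ≤ C := by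
  have hreg := isH1RegularOn_Ioc_of_serrin_forced_of_tao h hν hfs hfd hLH hr hqr hS
  obtain ⟨c, hc, hL2⟩ := h
  -- the first step from `t = 0`: datum `u₀ ∈ H¹`
  have hH1 : eH1NormSq u₀ < ⊤ := by
    rw [eH1NormSq_def]
    refine ENNReal.add_lt_top.2 ⟨?_, hu₀grad⟩
    rw [eEnergy_eq_eLpNorm_sq]
    exact ENNReal.pow_lt_top hu₀.2
  set A : ℝ := (eH1NormSq u₀).toReal with hAdef
  have hA : 0 ≤ A := ENNReal.toReal_nonneg
  have hAs : eH1NormSq u₀ ≤ ENNReal.ofReal A := (ENNReal.ofReal_toReal hH1.ne).ge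
  obtain ⟨B, hB, hBle⟩ := clayForce_lintegral_sqrt_eH1NormSq_translate_le hfs hfd T
  set τ₀ : ℝ := c * ν ^ 3 / ((Real.sqrt A + B) ^ 4 + 1) with hτ₀
  have hτ₀0 : 0 < τ₀ := by positivity
  set τ' : ℝ := min τ₀ T with hτ'def
  have hτ' : 0 < τ' := lt_min hτ₀0 hT
  have hτ'c : (Real.sqrt A + B) ^ 4 * τ' ≤ c * ν ^ 3 := by
    refine (mul_le_mul_of_nonneg_left (min_le_left _ _) (by positivity)).trans ?_
    rw [hτ₀, mul_div_assoc', div_le_iff₀ (by positivity)]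
    nlinarith [pow_nonneg (add_nonneg (Real.sqrt_nonneg A) hB) 4, mul_pos hc (pow_pos hν 3)]
  have hBs : ∫⁻ t in Ioo 0 τ', eH1NormSq (f t) ^ (2⁻¹ : ℝ) ≤ ENNReal.ofReal B := by
    have h := hBle 0 le_rfl τ' (min_le_right _ _)
    simpa only [add_zero] using h
  obtain ⟨v, hv, -, hvreg⟩ :=
    hL2.exists_isH1RegularOn hν hτ' hu₀ hu₀σ hfs hfd hA hB hAs hBs hτ'c
  have hSv : MemLqLp ∞ 6 v (Ioo 0 τ') :=
    memLqLp_top_six_of_isH1RegularOn_Icc hvreg fun t ht => hv.memLp t ht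
  have hqr6 : 2 / (⊤ : ℝ≥0∞) + 3 / 6 ≤ 1 := by
    rw [ENNReal.div_top, zero_add]
    exact ENNReal.div_le_of_le_mul (by norm_num)
  have hae : ∀ t ∈ Ioc 0 τ', u t =ᵐ[volume] v t :=
    serrinMasuda_weak_strong_uniqueness_forced hν hτ' (clayForce_prod_aestronglyMeasurable hfs)
      (clayForce_prod_eLpNorm_lt_top hfs hfd) hv hu₀ (q := ⊤) (r := 6) (by norm_num) hqr6 hSv
      (hLH.of_le (min_le_right _ _))
  -- bounds on `(0, τ']` and on `[τ', T]`
  obtain ⟨M₀, hM₀, hb₀⟩ := hvreg.exists_forall_le isCompact_Icc subset_rfl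
  have hKsub : Icc τ' T ⊆ Ioc 0 T := fun t ht => ⟨hτ'.trans_le ht.1, ht.2⟩
  obtain ⟨M₁, hM₁, hb₁⟩ := hreg.exists_forall_le isCompact_Icc hKsub
  refine ⟨M₀ + M₁, ENNReal.add_lt_top.2 ⟨hM₀, hM₁⟩, fun t ht => ?_⟩
  by_cases htτ : t ≤ τ'
  · rw [eH1NormSq_congr_ae (hae t ⟨ht.1, htτ⟩)]
    exact (hb₀ t ⟨ht.1.le, htτ⟩).trans le_self_add
  · exact (hb₁ t ⟨(not_le.1 htτ).le, ht.2⟩).trans le_add_self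

/-- **T23 of the cell `ns-blowup` ("the Sohr corner") as a THEOREM for Clay-class forces, modulo
Tao's forced local `H¹` theory** — the conclusion shape of the named fact
`Sohr2001_serrinClass_enstrophyBound_global` (`ForcedSerrinEnstrophyBound.lean`; Sohr 2001,
Thm. V.1.8.1, global-in-time form of the printed proof; Galdi–Gazzola 2026, Prop. 2.9: "no blow-up
instants"): under the hypotheses of `exists_eH1NormSq_le_of_serrin_forced_of_tao`, ONE constant
`C < ∞` bounds the enstrophy `‖∇u(t)‖²_{L²}` (the weak-gradient functional `eWeakGradL2Sq`) for
a.e. `t ∈ (0, T)` — the enstrophy cannot blow up at `T`. Exponent names follow Sohr (`s` time,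
`q` space: `3 < q ≤ ∞`, `3/q + 2/s ≤ 1`). The force class here is Fefferman's (smooth, rapidly
decaying), an honest subclass of Sohr's `L²(0,T; L²)`; NOT a discharge of the unguarded tree fact.
[cite: Sohr2001, Ch. V Thm. 1.8.1 (proof: reduction after (1.8.5) and the sentence following (1.8.20))]
[cite: GaldiGazzola2026, Prop. 2.9 (p. 7)] -/
theorem Sohr2001_serrinClass_enstrophyBound_clay_of_tao
    (h : tao2011_forced_H1_local_almost_regular) (hν : 0 < ν) (hT : 0 < T)
    (hfs : IsSmoothOnHalfSpace f) (hfd : HasRapidSpaceTimeDecay f)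
    (hu₀ : MemLp u₀ 2 volume) (hu₀σ : IsWeaklyDivFree u₀) (hu₀grad : eWeakGradL2Sq u₀ < ⊤)
    (hu : IsLerayHopfOn T ν f u₀ u) {s q : ℝ≥0∞} (hq : 3 < q) (hsq : 3 / q + 2 / s ≤ 1)
    (hS : MemLqLp s q u (Ioo 0 T)) :
    ∃ C : ℝ≥0, ∀ᵐ t ∂(volume.restrict (Ioo 0 T)), eWeakGradL2Sq (u t) ≤ C := by
  have hqr : 2 / s + 3 / q ≤ 1 := by rwa [add_comm] at hsq
  obtain ⟨C, hC, hb⟩ :=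
    exists_eH1NormSq_le_of_serrin_forced_of_tao h hν hT hfs hfd hu₀ hu₀σ hu₀grad hu hq hqr hS
  refine ⟨C.toNNReal, ?_⟩
  filter_upwards [ae_restrict_mem measurableSet_Ioo] with t ht
  rw [ENNReal.coe_toNNReal hC.ne]
  exact le_add_self.trans (hb t ⟨ht.1, ht.2.le⟩)

end Assembly

end Literature.Analysis.FluidPDE

end


/-! ## Appendix (second landing): Step B and the forced Ladyzhenskaya–Prodi–Serrin theorem -/

noncomputable section

open MeasureTheory TopologicalSpace Set Function Filter Topology InnerProductSpace Metric
open scoped RealInnerProductSpace ENNReal NNReal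

/-! ### Step B (forced): an `H¹`-regular forced Leray–Hopf solution has a classical representative -/

namespace Literature.Analysis.FluidPDE

section StepB

variable {ν T : ℝ} {f : ℝ → EuclideanSpace ℝ (Fin 3) → EuclideanSpace ℝ (Fin 3)}
  {u₀ : EuclideanSpace ℝ (Fin 3) → EuclideanSpace ℝ (Fin 3)}
  {u : ℝ → EuclideanSpace ℝ (Fin 3) → EuclideanSpace ℝ (Fin 3)}

/-- **`H¹`-regular forced Leray–Hopf solutions have a classical representative on `(0, T]`**
(Clay-class force), from Tao's forced local `H¹` theory (Robinson–Rodrigo–Sadowski 2016,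
Lemma 8.4 / Thm. 8.14: a Leray–Hopf solution is smooth on its set of regular times; Tao 2013,
Thm. 5.4 (iv) / Lemma 5.5 with force for the smoothing). If `u` is Leray–Hopf on `ℝ³ × [0, T)`
with a Clay-class force `f` and `‖u(t)‖²_{H¹}` is finite and continuous on `(0, T]`, there is a
classical solution `(v, p)` of the system forced by `f` on the time set `Ioc 0 T` with
`u(t) = v(t)` a.e. for every `t ∈ (0, T]`: each `t` lies in a classical patch issued from a good
restarting time just below it (`exists_tao_patch_forced`, with the `H¹` bound on the compact
`[t/2, T]` and the uniform force budget), translated back to `u`-time (the force `f(· + s)`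
translates back to `f`) and restricted to a relatively open piece of `(0, T]`, and the patches
glue (`exists_classical_Ioc_of_local`). The forced twin of the accepted
`exists_classical_Ioc_of_isH1RegularOn_tao`, same proof. [cite: RobinsonRodrigoSadowski2016, Lemma 8.4 (with Thm. 8.14)] -/
theorem exists_classical_Ioc_of_isH1RegularOn_tao_forced {c : ℝ}
    (hL2 : TaoForcedH1AlmostRegularWith c) (hc : 0 < c) (hν : 0 < ν)
    (hfs : IsSmoothOnHalfSpace f) (hfd : HasRapidSpaceTimeDecay f)
    (hLH : IsLerayHopfOn T ν f u₀ u) (hreg : IsH1RegularOn (Ioc 0 T) u) :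
    ∃ (v : ℝ → EuclideanSpace ℝ (Fin 3) → EuclideanSpace ℝ (Fin 3))
      (p : ℝ → EuclideanSpace ℝ (Fin 3) → ℝ),
      IsClassicalNSSolutionOn (Ioc 0 T) ν f v p ∧ ∀ t ∈ Ioc 0 T, u t =ᵐ[volume] v t := by
  obtain ⟨B, hB, hBle⟩ := clayForce_lintegral_sqrt_eH1NormSq_translate_le hfs hfd T
  have hfm := clayForce_prod_aestronglyMeasurable (T := T) hfs
  have hf2 := clayForce_prod_eLpNorm_lt_top (T := T) hfs hfd
  refine exists_classical_Ioc_of_local fun t ht => ?_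
  -- a uniform `H¹` bound on `[t/2, T]` and the corresponding lifespan
  have hKsub : Icc (t / 2) T ⊆ Ioc 0 T := fun s hs => ⟨lt_of_lt_of_le (by linarith [ht.1]) hs.1, hs.2⟩
  obtain ⟨M, hM, hbound⟩ := hreg.exists_forall_le isCompact_Icc hKsub
  set Am : ℝ := M.toReal with hAm
  have hAm0 : 0 ≤ Am := ENNReal.toReal_nonneg
  set τM : ℝ := c * ν ^ 3 / ((Real.sqrt Am + B) ^ 4 + 1) with hτM
  have hτM0 : 0 < τM := by positivity
  have hτMc : (Real.sqrt Am + B) ^ 4 * τM ≤ c * ν ^ 3 := by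
    rw [hτM, mul_div_assoc']
    rw [div_le_iff₀ (by positivity)]
    nlinarith [pow_nonneg (add_nonneg (Real.sqrt_nonneg Am) hB) 4, mul_pos hc (pow_pos hν 3)]
  have hgood : ∀ᵐ s ∂(volume.restrict (Ioo 0 T)),
      IsLerayHopfOn (T - s) ν (fun t => f (t + s)) (u s) (fun t => u (t + s)) :=
    hLH.ae_isLerayHopfOn_restart_forced hν.le hfm hf2
  -- a good time `s` just below `t`
  have hlo : 0 ≤ max (t / 2) (t - τM / 2) := le_max_of_le_left (by linarith [ht.1])
  have hlt : max (t / 2) (t - τM / 2) < t := max_lt (by linarith [ht.1]) (by linarith)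
  obtain ⟨s, hs, hLHs⟩ := exists_mem_Ioo_of_ae_restrict_Ioo hlo hlt ht.2 hgood
  have hs1 : t / 2 < s := (le_max_left _ _).trans_lt hs.1
  have hs2 : t - τM / 2 < s := (le_max_right _ _).trans_lt hs.1
  have hs0 : 0 < s := lt_of_le_of_lt (by linarith [ht.1]) hs1
  have hsT : s < T := hs.2.trans_le ht.2
  have hAs : eH1NormSq (u s) ≤ ENNReal.ofReal Am := by
    rw [hAm, ENNReal.ofReal_toReal hM.ne]; exact hbound s ⟨hs1.le, hs.2.le.trans ht.2⟩
  set τ' : ℝ := min τM (T - s) with hτ'def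
  have hBs : ∫⁻ t' in Ioo 0 τ', eH1NormSq (f (t' + s)) ^ (2⁻¹ : ℝ) ≤ ENNReal.ofReal B :=
    hBle s hs0.le _ ((min_le_right _ _).trans (by linarith))
  have htτ' : t - s ≤ τ' := le_min (by linarith) (by linarith [ht.2])
  set ε : ℝ := (t - s) / 2 with hεdef
  have hε0 : 0 < ε := by rw [hεdef]; linarith [hs.2]
  have hετ' : ε < τ' := lt_of_lt_of_le (by rw [hεdef]; linarith [hs.2]) htτ'
  obtain ⟨w, π, hw, -, -, -, hrep⟩ := exists_tao_patch_forced hL2 hν hfs hfd hLH ⟨hs0, hsT⟩ hLHs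
    hAm0 hB hAs hτM0 hBs hτMc (ε := ε) ⟨hε0, hετ'⟩
  -- the patch, translated back to `u`-time (the force becomes `f` again)
  have hcl : IsClassicalNSSolutionOn ((· + -s) ⁻¹' Icc ε τ') ν f (fun σ => w (σ + -s))
      (fun σ => π (σ + -s)) := by
    simpa only [neg_add_cancel_right] using hw.comp_add_right (-s)
  have key : ∀ cc : ℝ, t < cc → (∀ σ ∈ Ioc 0 T ∩ Ioo (s + ε) cc, σ - s ≤ τ') →
      ∃ a c' : ℝ, a < t ∧ t < c' ∧ ∃ (V : ℝ → EuclideanSpace ℝ (Fin 3) → EuclideanSpace ℝ (Fin 3))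
        (P : ℝ → EuclideanSpace ℝ (Fin 3) → ℝ),
        IsClassicalNSSolutionOn (Ioc 0 T ∩ Ioo a c') ν f V P ∧
          ∀ σ ∈ Ioc 0 T ∩ Ioo a c', u σ =ᵐ[volume] V σ := by
    intro cc htcc hcc
    have hsub : Ioc 0 T ∩ Ioo (s + ε) cc ⊆ (· + -s) ⁻¹' Icc ε τ' := fun σ hσ =>
      ⟨by simp only; linarith [hσ.2.1], by simp only; linarith [hcc σ hσ]⟩
    have hconv : Convex ℝ (Ioc 0 T ∩ Ioo (s + ε) cc) := (convex_Ioc 0 T).inter (convex_Ioo _ _)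
    have hint : (interior (Ioc 0 T ∩ Ioo (s + ε) cc)).Nonempty := by
      have hsub' : Ioo (s + ε) t ⊆ Ioc 0 T ∩ Ioo (s + ε) cc := fun σ hσ =>
        ⟨⟨by linarith [hσ.1], hσ.2.le.trans ht.2⟩, hσ.1, hσ.2.trans htcc⟩
      have hne : (Ioo (s + ε) t).Nonempty := nonempty_Ioo.2 (by rw [hεdef]; linarith [hs.2])
      rw [← isOpen_Ioo.interior_eq] at hne
      exact hne.mono (interior_mono hsub')
    refine ⟨s + ε, cc, by rw [hεdef]; linarith [hs.2], htcc, fun σ => w (σ + -s),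
      fun σ => π (σ + -s), hcl.mono hsub (uniqueDiffOn_convex hconv hint), fun σ hσ => ?_⟩
    have h := hrep (σ + -s) (hsub hσ)
    rwa [neg_add_cancel_right] at h
  by_cases htT : t < T
  · refine key (s + τ') ?_ fun σ hσ => by linarith [hσ.2.2]
    have : t - s < τ' := lt_min (by linarith) (by linarith)
    linarith
  · have htT' : t = T := le_antisymm ht.2 (not_lt.1 htT)
    refine key (T + 1) (by linarith [ht.2]) fun σ hσ => ?_
    linarith [hσ.1.2, htτ', htT']

end StepB

/-! ### Forced Ladyzhenskaya–Prodi–Serrin for Clay-class forces -/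

section LPS

variable {ν T : ℝ} {f : ℝ → EuclideanSpace ℝ (Fin 3) → EuclideanSpace ℝ (Fin 3)}
  {u₀ : EuclideanSpace ℝ (Fin 3) → EuclideanSpace ℝ (Fin 3)}
  {u : ℝ → EuclideanSpace ℝ (Fin 3) → EuclideanSpace ℝ (Fin 3)}

/-- **Ladyzhenskaya–Prodi–Serrin WITH a Clay-class force, from Tao's forced local `H¹` theory**
(Robinson–Rodrigo–Sadowski 2016, Thm. 8.17 with Lemma 8.16, forced; Sohr 2001, Thm. V.1.8.1 gives
the `W^{1,2} ∩ W^{2,2}` regularity for rough forces, here smoothness for smooth forces): every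
Leray–Hopf weak solution on `ℝ³ × [0, T)` of the Navier–Stokes system forced by `f` smooth on
`[0,∞) × ℝ³` with Fefferman's space-time decay, lying in a Serrin class `L^q(0,T; L^r)`,
`2/q + 3/r ≤ 1`, `3 < r ≤ ∞`, has a classical representative on `(0, T]`: a classical solution
`(v, p)` of the FORCED system on the time set `Ioc 0 T` with `u(t) = v(t)` a.e. for every
`t ∈ (0, T]` (the house form of the tree's ns.S07 `ladyzhenskaya_prodi_serrin`, forced). Proof:
`H¹`-regularity on `(0, T]` (`isH1RegularOn_Ioc_of_serrin_forced_of_tao`) and Step B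
(`exists_classical_Ioc_of_isH1RegularOn_tao_forced`). CONDITIONAL on the named fact
`tao2011_forced_H1_local_almost_regular`; the unforced twin is the tree theorem
`ladyzhenskaya_prodi_serrin_of_tao`. [cite: RobinsonRodrigoSadowski2016, Thm. 8.17 (with Lemma 8.16)] -/
theorem ladyzhenskaya_prodi_serrin_forced_of_tao (h : tao2011_forced_H1_local_almost_regular)
    (hν : 0 < ν) (hfs : IsSmoothOnHalfSpace f) (hfd : HasRapidSpaceTimeDecay f)
    (hLH : IsLerayHopfOn T ν f u₀ u) {q r : ℝ≥0∞} (hr : 3 < r) (hqr : 2 / q + 3 / r ≤ 1)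
    (hS : MemLqLp q r u (Ioo 0 T)) :
    ∃ (v : ℝ → EuclideanSpace ℝ (Fin 3) → EuclideanSpace ℝ (Fin 3))
      (p : ℝ → EuclideanSpace ℝ (Fin 3) → ℝ),
      IsClassicalNSSolutionOn (Ioc 0 T) ν f v p ∧ ∀ t ∈ Ioc 0 T, u t =ᵐ[volume] v t := by
  have hreg := isH1RegularOn_Ioc_of_serrin_forced_of_tao h hν hfs hfd hLH hr hqr hS
  obtain ⟨c, hc, hL2⟩ := h
  exact exists_classical_Ioc_of_isH1RegularOn_tao_forced hL2 hc hν hfs hfd hLH hreg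

end LPS

end Literature.Analysis.FluidPDE

end

/-! ## Appendix (third landing): the kill-shaped form — no enstrophy blow-up at `T` -/

noncomputable section

open MeasureTheory TopologicalSpace Set Function Filter Topology InnerProductSpace Metric
open scoped RealInnerProductSpace ENNReal NNReal

namespace Literature.Analysis.FluidPDE

section Kill

variable {ν T : ℝ} {f : ℝ → EuclideanSpace ℝ (Fin 3) → EuclideanSpace ℝ (Fin 3)}
  {u₀ : EuclideanSpace ℝ (Fin 3) → EuclideanSpace ℝ (Fin 3)}
  {u : ℝ → EuclideanSpace ℝ (Fin 3) → EuclideanSpace ℝ (Fin 3)}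

/-- **T23 ("Sohr corner") in the shape of a kill, for Clay-class forces, modulo Tao's forced local
`H¹` theory** (Sohr 2001, Thm. V.1.8.1, global form of the proof; Galdi–Gazzola 2026, Prop. 2.9 and
Def. 2.6: "no blow-up instants"): under the hypotheses of
`Sohr2001_serrinClass_enstrophyBound_clay_of_tao` — `u₀ ∈ H¹_σ`, a force smooth on `[0,∞) × ℝ³`
with Fefferman's decay, a Leray–Hopf velocity in a Serrin class `L^s(0,T; L^q)` up to `T` — the
enstrophy does NOT tend to `+∞` as `t → T⁻` (an essential bound on `(0, T)` is incompatible with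
`‖∇u(t)‖₂ → ∞`, which would hold on a left neighbourhood of `T`, a set of positive measure). The
theorem-grade twin of the tree's `Sohr2001_serrinClass_enstrophyBound_global.not_tendsto_atTop`
(which binds the unguarded named fact). [cite: Sohr2001, Ch. V Thm. 1.8.1 (proof, global form)]
[cite: GaldiGazzola2026, Prop. 2.9 (p. 7) and Def. 2.6 (p. 6)] -/
theorem not_tendsto_enstrophy_atTop_of_serrin_forced_of_tao
    (h : tao2011_forced_H1_local_almost_regular) (hν : 0 < ν) (hT : 0 < T)
    (hfs : IsSmoothOnHalfSpace f) (hfd : HasRapidSpaceTimeDecay f)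
    (hu₀ : MemLp u₀ 2 volume) (hu₀σ : IsWeaklyDivFree u₀) (hu₀grad : eWeakGradL2Sq u₀ < ⊤)
    (hu : IsLerayHopfOn T ν f u₀ u) {s q : ℝ≥0∞} (hq : 3 < q) (hsq : 3 / q + 2 / s ≤ 1)
    (hS : MemLqLp s q u (Ioo 0 T)) :
    ¬ Tendsto (fun t => eWeakGradL2Sq (u t)) (𝓝[<] T) atTop := by
  intro hlim
  obtain ⟨C, hC⟩ :=
    Sohr2001_serrinClass_enstrophyBound_clay_of_tao h hν hT hfs hfd hu₀ hu₀σ hu₀grad hu hq hsq hS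
  have hev : ∀ᶠ t in 𝓝[<] T, (C : ℝ≥0∞) + 1 ≤ eWeakGradL2Sq (u t) :=
    hlim.eventually (eventually_ge_atTop _)
  obtain ⟨ε, hε, hball⟩ := Metric.mem_nhdsWithin_iff.1 hev
  -- on `(a, T)`, `a = max 0 (T − ε/2)`: a.e. `≤ C` and everywhere `≥ C + 1`
  set a : ℝ := max 0 (T - ε / 2) with ha
  have haT : a < T := max_lt hT (by linarith)
  have hsub : Ioo a T ⊆ Ioo 0 T := Ioo_subset_Ioo_left (le_max_left _ _)
  have h1 : ∀ᵐ t ∂(volume.restrict (Ioo a T)), eWeakGradL2Sq (u t) ≤ C :=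
    ae_restrict_of_ae_restrict_of_subset hsub hC
  have h2 : ∀ᵐ t ∂(volume.restrict (Ioo a T)), (C : ℝ≥0∞) + 1 ≤ eWeakGradL2Sq (u t) := by
    filter_upwards [ae_restrict_mem measurableSet_Ioo] with t ht
    apply hball
    refine ⟨?_, ht.2⟩
    rw [Metric.mem_ball, Real.dist_eq, abs_lt]
    constructor <;> linarith [ht.1, ht.2, le_max_right 0 (T - ε / 2)]
  have h3 : ∀ᵐ t ∂(volume.restrict (Ioo a T)), False := by
    filter_upwards [h1, h2] with t h1 h2
    have hlt : (C : ℝ≥0∞) < C + 1 := ENNReal.lt_add_right ENNReal.coe_ne_top one_ne_zero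
    exact absurd (h2.trans h1) (not_le.2 hlt)
  rw [eventually_false_iff_eq_bot, ae_eq_bot, Measure.restrict_eq_zero, Real.volume_Ioo,
    ENNReal.ofReal_eq_zero] at h3
  linarith

end Kill

end Literature.Analysis.FluidPDE

end
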